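import Mathlib
import HarnessLib

/-!
# R52 §A: THE FIRST INTEGRAL OF THE AXIS ODE and THE KINETIC OUTFLOW REACH LAW
# (nsreg-p2 ROUND-52 «PROVENANCE» v1.2 bca60ece7b3dcb40, `r52/Sketch52.v1.2.lean` 60bfd4b645ab26b0 §A l.50–139 VERBATIM —
# `NsregP2.R52.Provenance.hasDerivAt_axisFirstIntegral(_of_pressureless)`, `kineticOutflowReach` (= `KineticOutflowReach γ` unfolded);
# plates t55-LAWS (A) + t55-REACH; seat ns-sfl-p1 g9, `--supports stmt-NavierStokesRegularity-19832 --as helper`)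

On a straight axis `σ ↦ σe` carrying `U(σe) = u(σ)e` the self-similar Euler profile equation reads
`(1−γ)u + (γσ + u)u′ + q = 0`, `q = ∂_eP` (tree `ClassicalProfile.axisODE`).  Then, wherever `u ≠ 0`, `u ≠ −σ`,
`d/dσ [ γ·log|u| + (1−γ)·log|u + σ| ] = −q / (u(u+σ))` (`hasDerivAt_axisFirstIntegral`), so for `q ≡ 0` the quantity
`|u|^γ |u+σ|^{1−γ}` is conserved along the axis (`hasDerivAt_axisFirstIntegral_of_pressureless`).  Outflow (`u > 0`): the
KINETIC REACH LAW `KineticOutflowReach γ` — a pressureless outflow thread is ℋ-high (`γσ + u ≥ √(γ(1−γ))·σ`) only out to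
`σ ≤ u₀^γ(u₀+σ₀)^{1−γ} / (κ^γ(1+κ)^{1−γ})`, `κ = √(γ(1−γ)) − γ` — PROVED for `0 < γ ≤ ½` (`kineticOutflowReach`).

HONEST FRAMING: facts about real ODEs (instruments for ROUND-52's inflow/outflow side of hypothetical self-similar Euler profiles);
nothing about the crux E (19832 OPEN) or NS regularity is proved here. [nsreg-p2 R52 §A; folklore]
-/

noncomputable section

set_option linter.dupNamespace false

open Set Filter Topology Metric Function
open scoped Topology

namespace Summit.NavierStokesRegularity.NavierStokesRegularity.Theorems.PowerGaugeEulerLiouville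

namespace ClassicalProfile

/-! ## §A  The first integral of the axis ODE -/

/-- **FIRST INTEGRAL OF THE AXIS ODE, with forcing (exact).**  If `(1−γ)u(σ) + (γσ + u(σ))·u′ + q = 0` at a point where `u(σ) ≠ 0` and
`u(σ) ≠ −σ`, then `σ ↦ γ·log|u| + (1−γ)·log|u + σ|` has derivative `−q/(u(σ)(u(σ)+σ))` there (`Real.log` is `log ∘ |·|`).
(proof: nsreg-p2 g42, `r52/Sketch52.lean`, verbatim) [nsreg-p2 R52 §A; folklore] -/
theorem hasDerivAt_axisFirstIntegral {γ σ u' q : ℝ} {u : ℝ → ℝ} (hu : HasDerivAt u u' σ) (hu0 : u σ ≠ 0) (huσ : u σ + σ ≠ 0)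
    (hode : (1 - γ) * u σ + (γ * σ + u σ) * u' + q = 0) :
    HasDerivAt (fun τ => γ * Real.log (u τ) + (1 - γ) * Real.log (u τ + τ)) (-(q / (u σ * (u σ + σ)))) σ := by
  have h1 : HasDerivAt (fun τ => Real.log (u τ)) (u' / u σ) σ := hu.log hu0
  have h2 : HasDerivAt (fun τ => u τ + τ) (u' + 1) σ := hu.add (hasDerivAt_id σ)
  have h3 : HasDerivAt (fun τ => Real.log (u τ + τ)) ((u' + 1) / (u σ + σ)) σ := h2.log huσ
  have h := (h1.const_mul γ).add (h3.const_mul (1 - γ))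
  refine h.congr_deriv ?_
  rw [eq_neg_iff_add_eq_zero, mul_div_assoc', mul_div_assoc', div_add_div _ _ hu0 huσ, ← add_div, div_eq_zero_iff]
  left
  linear_combination hode

/-- **Pressureless case: `|u|^γ·|u+σ|^{1−γ}` is conserved** (derivative of its logarithm vanishes).
(proof: nsreg-p2 g42, verbatim) [nsreg-p2 R52 §A; folklore] -/
theorem hasDerivAt_axisFirstIntegral_of_pressureless {γ σ u' : ℝ} {u : ℝ → ℝ} (hu : HasDerivAt u u' σ) (hu0 : u σ ≠ 0)
    (huσ : u σ + σ ≠ 0) (hode : (1 - γ) * u σ + (γ * σ + u σ) * u' = 0) :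
    HasDerivAt (fun τ => γ * Real.log (u τ) + (1 - γ) * Real.log (u τ + τ)) 0 σ := by
  have h := hasDerivAt_axisFirstIntegral (q := 0) hu hu0 huσ (by rw [add_zero]; exact hode)
  simpa using h

/-- **KINETIC OUTFLOW REACH LAW, PROVED for `0 < γ ≤ ½`** (plate t55-REACH; the statement is `NsregP2.R52.Provenance.KineticOutflowReach γ`
VERBATIM, unfolded; proof: nsreg-p2 g42, `r52/Sketch52.lean` v1.1 l.86–139, verbatim).  A pressureless outflow thread (`u > 0`,
`(1−γ)u + (γσ+u)u′ = 0` on `[σ₀, σ₁]`, `0 < σ₀`) that is still ℋ-HIGH at `σ₁` in the kinetic sense `γσ₁ + u(σ₁) ≥ √(γ(1−γ))·σ₁` satisfies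
`σ₁·κ^γ(1+κ)^{1−γ} ≤ u(σ₀)^γ (u(σ₀)+σ₀)^{1−γ}`, `κ = √(γ(1−γ)) − γ` (`> 0` iff `γ < ½`): THE REACH OF OUTFLOW IS LINEAR IN THE LAUNCH SPEED.
Proof: the first integral is constant on `[σ₀, σ₁]` (mean value theorem with derivative `0`), `u^γ(u+σ)^{1−γ} = exp F`, and at `σ₁` the
kinetic height `u(σ₁) ≥ κσ₁`, `u(σ₁)+σ₁ ≥ (1+κ)σ₁` with `rpow` monotone. [nsreg-p2 R52 §A] -/
theorem kineticOutflowReach {γ : ℝ} (hγ : 0 < γ) (hγ' : γ ≤ 1 / 2) :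
    ∀ (u : ℝ → ℝ) (σ₀ σ₁ : ℝ), 0 < σ₀ → σ₀ ≤ σ₁ →
      (∀ σ ∈ Icc σ₀ σ₁, 0 < u σ) →
      (∀ σ ∈ Icc σ₀ σ₁, ∃ u' : ℝ, HasDerivAt u u' σ ∧ (1 - γ) * u σ + (γ * σ + u σ) * u' = 0) →
      Real.sqrt (γ * (1 - γ)) * σ₁ ≤ γ * σ₁ + u σ₁ →
      σ₁ * ((Real.sqrt (γ * (1 - γ)) - γ) ^ γ * (1 + (Real.sqrt (γ * (1 - γ)) - γ)) ^ (1 - γ)) ≤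
        u σ₀ ^ γ * (u σ₀ + σ₀) ^ (1 - γ) := by
  intro u σ₀ σ₁ hσ₀ hle hpos hode hhigh
  have h1γ : 0 < 1 - γ := by linarith
  have hσ₁ : 0 < σ₁ := lt_of_lt_of_le hσ₀ hle
  have hu0 : 0 < u σ₀ := hpos σ₀ (left_mem_Icc.2 hle)
  have hu1 : 0 < u σ₁ := hpos σ₁ (right_mem_Icc.2 hle)
  set κ := Real.sqrt (γ * (1 - γ)) - γ with hκ
  have hκ0 : 0 ≤ κ := by
    have : γ ≤ Real.sqrt (γ * (1 - γ)) := by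
      calc γ = Real.sqrt (γ ^ 2) := (Real.sqrt_sq hγ.le).symm
        _ ≤ Real.sqrt (γ * (1 - γ)) := Real.sqrt_le_sqrt (by nlinarith)
    linarith
  -- the first integral and its constancy on `[σ₀, σ₁]`
  set F : ℝ → ℝ := fun τ => γ * Real.log (u τ) + (1 - γ) * Real.log (u τ + τ) with hF
  have hFd : ∀ σ ∈ Icc σ₀ σ₁, HasDerivAt F 0 σ := by
    intro σ hσ
    obtain ⟨u', hu, hode'⟩ := hode σ hσ
    have hσpos : 0 < σ := lt_of_lt_of_le hσ₀ hσ.1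
    exact hasDerivAt_axisFirstIntegral_of_pressureless hu (hpos σ hσ).ne' (by linarith [hpos σ hσ]) hode'
  have hFeq : F σ₁ = F σ₀ := by
    rcases eq_or_lt_of_le hle with h | h
    · rw [h]
    · have hcont : ContinuousOn F (Icc σ₀ σ₁) := fun σ hσ => (hFd σ hσ).continuousAt.continuousWithinAt
      obtain ⟨c, -, hc'⟩ := exists_hasDerivAt_eq_slope F (fun _ => (0 : ℝ)) h hcont
        (fun x hx => hFd x (Ioo_subset_Icc_self hx))
      have hne : σ₁ - σ₀ ≠ 0 := by linarith
      rcases (div_eq_zero_iff.mp hc'.symm) with h0 | h0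
      · linarith
      · exact absurd h0 hne
  -- exponentiate
  have e : ∀ σ, 0 < u σ → 0 < u σ + σ → u σ ^ γ * (u σ + σ) ^ (1 - γ) = Real.exp (F σ) := by
    intro σ h1 h2
    rw [hF, Real.rpow_def_of_pos h1, Real.rpow_def_of_pos h2, ← Real.exp_add]
    congr 1
    ring
  have key : u σ₁ ^ γ * (u σ₁ + σ₁) ^ (1 - γ) = u σ₀ ^ γ * (u σ₀ + σ₀) ^ (1 - γ) := by
    rw [e σ₁ hu1 (by linarith), e σ₀ hu0 (by linarith), hFeq]
  -- the kinetic height at `σ₁`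
  have hu1κ : κ * σ₁ ≤ u σ₁ := by rw [hκ, sub_mul]; linarith
  have hu1κ' : (1 + κ) * σ₁ ≤ u σ₁ + σ₁ := by linarith
  have a : (κ * σ₁) ^ γ ≤ u σ₁ ^ γ := Real.rpow_le_rpow (mul_nonneg hκ0 hσ₁.le) hu1κ hγ.le
  have b : ((1 + κ) * σ₁) ^ (1 - γ) ≤ (u σ₁ + σ₁) ^ (1 - γ) :=
    Real.rpow_le_rpow (mul_nonneg (by linarith) hσ₁.le) hu1κ' h1γ.le
  have hσpow : σ₁ ^ γ * σ₁ ^ (1 - γ) = σ₁ := by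
    rw [← Real.rpow_add hσ₁, show γ + (1 - γ) = 1 by ring, Real.rpow_one]
  have c : (κ * σ₁) ^ γ * ((1 + κ) * σ₁) ^ (1 - γ) = σ₁ * (κ ^ γ * (1 + κ) ^ (1 - γ)) := by
    rw [Real.mul_rpow hκ0 hσ₁.le, Real.mul_rpow (by linarith) hσ₁.le]
    calc κ ^ γ * σ₁ ^ γ * ((1 + κ) ^ (1 - γ) * σ₁ ^ (1 - γ))
        = κ ^ γ * (1 + κ) ^ (1 - γ) * (σ₁ ^ γ * σ₁ ^ (1 - γ)) := by ring
      _ = σ₁ * (κ ^ γ * (1 + κ) ^ (1 - γ)) := by rw [hσpow]; ring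
  rw [← key]
  calc σ₁ * (κ ^ γ * (1 + κ) ^ (1 - γ)) = (κ * σ₁) ^ γ * ((1 + κ) * σ₁) ^ (1 - γ) := c.symm
    _ ≤ u σ₁ ^ γ * (u σ₁ + σ₁) ^ (1 - γ) :=
        mul_le_mul a b (Real.rpow_nonneg (mul_nonneg (by linarith) hσ₁.le) _) (Real.rpow_nonneg hu1.le _)

end ClassicalProfile

end Summit.NavierStokesRegularity.NavierStokesRegularity.Theorems.PowerGaugeEulerLiouville

end
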